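import Literature.AlgebraicGeometry.Resolution.PointBlowupNoDoubleJumpLowestLayer
import Literature.AlgebraicGeometry.Resolution.PointBlowupMohStability
import HarnessLib

/-!
# No two consecutive shade increases under point blow-ups at order `pᵉ` — every `e`, every dimension

Topic: `Literature/AlgebraicGeometry/Resolution`. Companion (cell `pub-hironaka`, unit
`b2b-hironaka-cp4`, DIM-4 CENSUS gen 15) of

* `PointBlowupMohBound.lean` (gen 11): at order `p` (`e = 1`), after an increase of the shade the
  next point blow-up does not increase it again, in every dimension
  (`PointBlowup.not_shadeIncreases_step_of_shadeIncreases`);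
* `PointBlowupMohBoundPrimePower.lean` (gen 14): Moh's one-step bound `shade′ ≤ shade + p^{e−1}`
  at order `q = pᵉ` for every `e`, with the HASSE PROBE `exists_support_step_of_choose_ne_zero'`
  (`D^{(p^k e_{i₀})}`, slack `min(p^k, r_{i₀})`) and the necessary conditions
  `necessary_of_shadeIncreases_pow`;
* `PointBlowupNoDoubleJumpLowestLayer.lean` (gen 14): at order `pᵉ`, two consecutive increases
  force every initial monomial of the intermediate residual polynomial `F′` into a higher
  `y_j`-layer (`consecutive_shadeIncreases_pow`, "Case B"), the lowest-layer case ("Case A")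
  being impossible (`not_shadeIncreases_step_of_mem_lowestLayer`).

## What is proved (every prime `p`, every `e`, every field `K` of characteristic `p`, every finite
## index type `σ` of residual variables — hypersurfaces `x^{pᵉ} + F(y) = 0` of EVERY dimension)

* **`PointBlowup.not_shadeIncreases_step_of_shadeIncreases_pow` — NO TWO CONSECUTIVE INCREASES AT
  ORDER `pᵉ`.** For a cleaned state `s = (F, r)` (`deletePthPowers q F = F`, `yʳ ∣ F`,
  `ord₀ F = o ≥ q = pᵉ`): if the shade increases at the point `b` of the `y_j`-chart, then at the
  NEXT point blow-up of the new state — any chart `y_{j′}`, any point `b′` of its exceptional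
  divisor at which the order is still `≥ q` — the shade does NOT increase again. The `e = 1`
  theorem of `PointBlowupMohBound.lean` is the case `q = p`; the residual "Case B" left open by
  `PointBlowupNoDoubleJumpLowestLayer.lean` (the cell's typed question Q37.7 of
  `OBSTRUCTIONS-DIM4.md` §37.7, as far as consecutive increases are concerned) is CLOSED: it does
  not occur together with `q ∣ ord₀ F′`.
* `PointBlowup.not_shadeIncreases_step_of_shadeIncreases_pow'` — the same with the hypothesis
  "order still `≥ q`" in the form `(q : ℕ∞) ≤ ord₀ F′` (`step_F_ne_zero_pow`: a step of a cleaned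
  state of order `≥ q` is never the zero polynomial).
* `PointBlowup.not_isKangarooPoint_step_of_isKangarooPoint` — in the words of [Hauser2010, §G]:
  **a kangaroo point is never followed by a kangaroo point**, at any order `pᵉ`, in any dimension.
* `PointBlowup.shade_isolated_increases_along_pow` — along any sequence of point blow-ups on the
  equimultiple branch (order `≥ q` throughout), increases are ISOLATED, and over any two
  consecutive steps the shade rises by at most `p^{e−1}` (with `shade_succ_le_along_pow`).
* `PointBlowup.exists_initial_lowestLayer_of_pow_dvd` — **Moh's term `A` at every `e`**: if after
  the increase the new order `o₁` IS divisible by `q` (the only case in which a further increase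
  is arithmetically possible), then some exceptional component `{y_{i₀} = 0}` lost at `b` — now
  NON-exceptional, `r′_{i₀} = 0` — carries an INITIAL monomial `y^E` of `F′` (`|E| = o₁`) in the
  lowest `y_j`-layer with `q ∤ E_{i₀}`, and `shade′ ≤ shade + E_{i₀}` ([Moh1987] p. 972 "Statement":
  "`F` has a term `A` with … `ord_{x_s} A = c` … `p^{r+1} ∤ c`", "now `x_s` is an `X`-kind of
  variable"; for `e = 1` this is `exists_nonexceptional_of_shadeIncreases` of
  `PointBlowupMohBound.lean`, where `p ∣ o₁` is not needed).
* `PointBlowup.exists_shade_step_origin_le_of_pow_dvd` — **Moh's case (1) at every `e`, valuation-free**: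
  in that situation the blow-up of the ORIGIN of the `y_{i₀}`-chart of the new state brings the
  shade back to at most its value BEFORE the jump (`shade″ + E_{i₀} ≤ shade′ ≤ shade + E_{i₀}`;
  [Moh1987] p. 972 case (1): "we have to factor out `x_s` and do it without any translation. Due to
  the existence of the term `A`, the order of `F` will drop at least by `c`"), via the
  general-modulus theorem `shade_step_add_le_of_untranslated` of `PointBlowupMohStability.lean`.

## Method (derived by the cell; elementary, on top of the gen-14 probe — about forty lines of
## mathematics)

Let the shade increase at `(j, b)`: `o₁ := ord₀ F′ > θ := |r′| + shade` (the "threshold"), and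
suppose the next blow-up increases it again. Then `q ∣ o₁` (Probe 1 at the second step) and, by
`consecutive_shadeIncreases_pow`, every initial monomial of `F′` lies in a layer `E_j > o − q`.
Let `κ` be the LEAST `k` such that some lost exceptional index `i` (`i ≠ j`, `b_i ≠ 0`, `r_i ≠ 0`)
carries an initial exponent `d_i` of `F` with `(d_i choose p^k) ≢ 0 (mod p)` (it exists, with
`κ < e`, by `necessary_of_shadeIncreases_pow` (iii) and Lucas); so `π := p^κ` divides EVERY
exponent of EVERY initial monomial of `F` (at untranslated or non-exceptional indices the
exponents are even `≡ 0 (mod q)` by (ii); at `j` by `q ∣ o`). The Hasse probe at a minimising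
pair `(d₀, i₀)` yields `E ∈ supp F′` in the lowest layer (`E_j = o − q`) with
`|E| ≤ θ + min(π, r_{i₀}) ≤ θ + π`. Now `E` is a Taylor monomial of the translate of the chart
image of an initial monomial `y^d` of `F`, all of whose exponents are divisible by `π`; by Lucas
(`(n choose m) ≢ 0 (mod p)` and `p^κ ∣ n` force `p^κ ∣ m`, `pow_dvd_of_not_dvd_choose`) every
exponent of `E` is divisible by `π`, so `π ∣ |E|`; and `π ∣ q ∣ o₁`. Since `E` is not initial
(Case B) we get `|E| ≥ o₁ + 1`, hence `|E| ≥ o₁ + π`, hence `o₁ ≤ θ` — contradicting the first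
increase. (Equivalently: whenever `q ∣ ord₀ F′` after a jump, the probe monomial is initial and
Case A applies.)

## What is printed, and what is NOT claimed

[Moh1987] p. 966 states the Stability Theorem for all `e` along a valuation ("successive permissible
blow-ups will not increase `ord F̄` beyond the bound `d + p^{e−1}` … until it drops to `d` or
less") and p. 972 treats the blow-up after an increase in two cases; [Hauser2010] §F p. 16: "in the
next blowup the shade has to drop at least by 1 (if `e = 1`)"; [HauserPerlega2019] §3: Moh's
sequence claim "is known to be valid for `e = 1`" and is FALSE for `e ≥ 3`
(`Literature.Barriers.ResolutionOfSingularities.mohStabilityClaim_false`); [HauserPerlega2024] §7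
p. 798: in higher dimension "the question … is still unsolved". None of these sources states the
theorem proved here for `e ≥ 2`; it is DERIVED by the cell in the model of `PointBlowupShade.lean`
and tagged `[folklore]` (new but elementary). It says nothing about divergence along long
sequences (the Hauser–Perlega cycles have isolated increases separated by long valleys) and is
NOT a statement about resolution of singularities; census value only (row O5 of the dimension-4
census of `pub-hironaka`: at every purely inseparable multiplicity `pᵉ` and in every dimension the
classical residual datum never jumps twice in a row; consistent with the cell's kit probe, 0
consecutive increases in 3 647 081 sampled second steps at `e ∈ {2, 3}`, `OBSTRUCTIONS-DIM4.md`
§37.10). The reading notes R-Moh-1 of `PointBlowupMohBound.lean` (cleaning vs. perfectness;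
non-equiconstant points) apply verbatim.
-/

noncomputable section

open MvPolynomial Finset

open scoped BigOperators

namespace Literature.AlgebraicGeometry.Resolution

open Literature.AlgebraicGeometry.Resolution.Hauser2010
open Literature.Barriers.ResolutionOfSingularities
open Literature.AlgebraicGeometry.Resolution.WeightedBlowup

/-! ## 1. Lucas, digitwise: `p^s ∣ n` and `(n choose m) ≢ 0 (mod p)` force `p^s ∣ m` -/

section Lucas

variable (p : ℕ) [hp : Fact p.Prime]

/-- If `p^s ∣ n` and `p ∤ (n choose m)` then `p^s ∣ m`: by Lucas' theorem the `p`-adic digits of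
`m` are bounded by those of `n`, whose `s` lowest digits vanish. [folklore] -/
theorem pow_dvd_of_not_dvd_choose {s n m : ℕ} (hn : p ^ s ∣ n) (hc : ¬ p ∣ n.choose m) :
    p ^ s ∣ m := by
  induction s generalizing n m with
  | zero => rw [pow_zero]; exact one_dvd m
  | succ s ih =>
    have hp1 : p ∣ n := dvd_trans (dvd_pow_self p (Nat.succ_ne_zero s)) hn
    have hmod : n % p = 0 := Nat.mod_eq_zero_of_dvd hp1
    have hL := Choose.choose_modEq_choose_mod_mul_choose_div_nat (n := n) (k := m) (p := p)
    rw [hmod] at hL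
    -- the lowest digit of `m` vanishes
    have hm0 : m % p = 0 := by
      by_contra hne
      apply hc
      have h0 : (0 : ℕ).choose (m % p) = 0 := Nat.choose_eq_zero_of_lt (Nat.pos_of_ne_zero hne)
      rw [h0, zero_mul] at hL
      exact Nat.modEq_zero_iff_dvd.mp hL
    rw [hm0, Nat.choose_zero_right, one_mul] at hL
    -- and the remaining digits are those of `m / p` against `n / p`
    have hc' : ¬ p ∣ (n / p).choose (m / p) := fun h =>
      hc (Nat.modEq_zero_iff_dvd.mp (hL.trans (Nat.modEq_zero_iff_dvd.mpr h)))
    have hn' : p ^ s ∣ n / p := by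
      obtain ⟨t, rfl⟩ := hn
      rw [pow_succ', mul_assoc, Nat.mul_div_cancel_left _ hp.out.pos]
      exact dvd_mul_right _ _
    have hdiv := ih hn' hc'
    have hm : m = p * (m / p) := (Nat.mul_div_cancel' (Nat.dvd_of_mod_eq_zero hm0)).symm
    rw [hm, pow_succ']
    exact mul_dvd_mul_left p hdiv

variable (K : Type*) [CommRing K] [CharP K p]

/-- **All Hasse digits below `κ` vanish ⇒ `p^κ` divides**: if `(m choose p^k) = 0` in characteristic
`p` for every `k < κ`, then `p^κ ∣ m` (the converse of
`natCast_choose_prime_pow_eq_zero_of_pow_dvd`). [folklore] -/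
theorem pow_dvd_of_forall_natCast_choose_eq_zero {m κ : ℕ}
    (h : ∀ k, k < κ → ((m.choose (p ^ k) : ℕ) : K) = 0) : p ^ κ ∣ m := by
  induction κ with
  | zero => rw [pow_zero]; exact one_dvd m
  | succ κ ih =>
    have h1 : p ^ κ ∣ m := ih fun k hk => h k (Nat.lt_succ_of_lt hk)
    have h2 : p ∣ m / p ^ κ :=
      (natCast_choose_prime_pow_eq_zero_iff p K m κ).mp (h κ (Nat.lt_succ_self κ))
    obtain ⟨u, hu⟩ := h2
    have hm : m = p ^ κ * (m / p ^ κ) := (Nat.mul_div_cancel' h1).symm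
    rw [hm, hu, ← mul_assoc, ← pow_succ]
    exact dvd_mul_right _ _

end Lucas

namespace PointBlowup

section Main

variable {σ : Type*} {K : Type*} [Field K] [Fintype σ] [DecidableEq σ] [DecidableEq K]
variable (p : ℕ) [hp : Fact p.Prime] [CharP K p]

omit [DecidableEq K] in
/-- **Taylor monomials inherit `p^κ`-divisibility**: if every exponent of `y^e` is divisible by
`p^κ`, so is every exponent of every monomial `y^E` of `(y + b)^e` (in characteristic `p`,
`(y_t + b_t)^{p^κ m} = (y_t^{p^κ} + b_t^{p^κ})^m`; here via the Taylor coefficient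
`∏_t (e_t choose E_t) b_t^{e_t − E_t}` and Lucas). [folklore] -/
theorem pow_dvd_apply_of_coeff_translate_monomial_ne_zero (b : σ → K) {κ : ℕ} {e E : σ →₀ ℕ}
    {a : K} (he : ∀ t, p ^ κ ∣ e t) (h : coeff E (translate b (monomial e a)) ≠ 0) (t : σ) :
    p ^ κ ∣ E t := by
  rw [coeff_translate_monomial] at h
  have h1 := (mul_ne_zero_iff.mp h).2
  rw [Finset.prod_ne_zero_iff] at h1
  have h2 := (mul_ne_zero_iff.mp (h1 t (Finset.mem_univ t))).1
  have h3 : ¬ p ∣ (e t).choose (E t) := fun hd => h2 ((CharP.cast_eq_zero_iff K p _).mpr hd)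
  exact pow_dvd_of_not_dvd_choose p (he t) h3

/-- **A step of a cleaned state of order `≥ q = pᵉ` is never the zero polynomial** (so orders stay
finite along a sequence): by Probe 1 or the Hasse probe, the cleaned translated chart transform
has a monomial. [folklore] -/
theorem step_F_ne_zero_pow {e : ℕ} (j : σ) (b : σ → K) (hbj : b j = 0) (s : State σ K)
    (hclean : deletePthPowers (p ^ e) s.F = s.F) {o : ℕ} (ho : ordZero s.F = o)
    (hqo : p ^ e ≤ o) (hr : ∀ d ∈ s.F.support, s.r ≤ d) : (step (p ^ e) j b s).F ≠ 0 := by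
  intro h0
  obtain ⟨⟨d₀, hd₀, hd₀deg⟩, -⟩ := (ordZero_eq_nat_iff _ _).mp ho
  have hd₀s : d₀ ∈ s.F.support := MvPolynomial.mem_support_iff.mpr hd₀
  have hnp := not_isPthPowerExponent_of_clean (p ^ e) hclean hd₀s
  by_cases hdvd : p ^ e ∣ o
  · obtain ⟨i₀, hi₀, hd₀i⟩ := exists_ne_not_dvd (p ^ e) j (hd₀deg.symm ▸ hdvd) hnp
    obtain ⟨k, hk, hk0⟩ := exists_natCast_choose_prime_pow_ne_zero p K hd₀i
    obtain ⟨E, hE, -⟩ :=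
      exists_support_step_of_choose_ne_zero p j b hbj s ho hqo hr hi₀ hk hd₀s hd₀deg hk0
    rw [h0, MvPolynomial.support_zero] at hE
    exact Finset.notMem_empty _ hE
  · obtain ⟨E, hE, -⟩ := exists_support_step_of_not_dvd (p ^ e) j b hbj s ho hqo hr hdvd
    rw [h0, MvPolynomial.support_zero] at hE
    exact Finset.notMem_empty _ hE

/-- **No two consecutive increases at order `pᵉ`, in every dimension, for every `e`.** If the
shade of a cleaned state `(F, r)` (`yʳ ∣ F`, `ord₀ F = o ≥ q = pᵉ`) increases at the point `b` of
the `y_j`-chart, then at the NEXT point blow-up of the new state — any chart `y_{j′}`, any point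
`b′` of its exceptional divisor, order `ord₀ F′ = o₁ ≥ q` — the shade does NOT increase again.
Derived by the cell from the Hasse probe of `PointBlowupMohBoundPrimePower.lean` (slack
`min(p^κ, r_{i₀})` at the least Hasse digit `κ`), the layer alternative of
`PointBlowupNoDoubleJumpLowestLayer.lean`, and `p^κ`-divisibility of the degrees in the lowest
layer (Lucas); the printed remarks it extends are the `e = 1` statements [Moh1987] p. 972,
[Hauser2010] §F p. 16, [HauserPerlega2019] §3 ("known to be valid for `e = 1`"). Not a printed
theorem for `e ≥ 2`. [folklore] -/
theorem not_shadeIncreases_step_of_shadeIncreases_pow {e : ℕ} (j : σ) (b : σ → K) (hbj : b j = 0)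
    (s : State σ K) (hclean : deletePthPowers (p ^ e) s.F = s.F) {o : ℕ} (ho : ordZero s.F = o)
    (hqo : p ^ e ≤ o) (hr : ∀ d ∈ s.F.support, s.r ≤ d) (hinc : ShadeIncreases (p ^ e) j b s)
    {o₁ : ℕ} (ho₁ : ordZero (step (p ^ e) j b s).F = o₁) (hqo₁ : p ^ e ≤ o₁)
    (j' : σ) (b' : σ → K) (hbj' : b' j' = 0) :
    ¬ ShadeIncreases (p ^ e) j' b' (step (p ^ e) j b s) := by
  intro hinc'
  set q : ℕ := p ^ e with hqdef
  have hdeg := le_degree_of_ordZero_eq s ho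
  have hdeg₁ := le_degree_of_ordZero_eq (step q j b s) ho₁
  obtain ⟨hqdvd, hfix, i₁, hi₁, hbi₁, hri₁, d₁, hd₁, hd₁deg, hd₁i⟩ :=
    necessary_of_shadeIncreases_pow p j b hbj s hclean ho hqo hr hinc
  have hclean₁ := deletePthPowers_step q j b s
  have hr₁ := newMult_le_of_mem_support_step q j b hbj s ho hr
  obtain ⟨hqdvd₁, -, -⟩ :=
    necessary_of_shadeIncreases_pow p j' b' hbj' (step q j b s) hclean₁ ho₁ hqo₁ hr₁ hinc'
  -- Case B: every initial monomial of `F′` lies above the lowest `y_j`-layer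
  have hB := consecutive_shadeIncreases_pow p j b hbj s hclean ho hqo hr hinc ho₁ hqo₁ j' b' hbj'
    hinc'
  -- `κ`: the least Hasse digit at which a lost exceptional index sees an initial exponent
  have hP : ∃ k, ∃ d ∈ s.F.support, d.degree = o ∧ ∃ i, i ≠ j ∧ b i ≠ 0 ∧ s.r i ≠ 0 ∧
      (((d i).choose (p ^ k) : ℕ) : K) ≠ 0 := by
    obtain ⟨k, -, hk0⟩ := exists_natCast_choose_prime_pow_ne_zero p K hd₁i
    exact ⟨k, d₁, hd₁, hd₁deg, i₁, hi₁, hbi₁, hri₁, hk0⟩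
  classical
  have hspec := Nat.find_spec hP
  have hmin' : ∀ {m : ℕ}, m < Nat.find hP → ¬ (∃ d ∈ s.F.support, d.degree = o ∧
      ∃ i, i ≠ j ∧ b i ≠ 0 ∧ s.r i ≠ 0 ∧ (((d i).choose (p ^ m) : ℕ) : K) ≠ 0) :=
    fun hm => Nat.find_min hP hm
  have hle' : ∀ {m : ℕ}, (∃ d ∈ s.F.support, d.degree = o ∧
      ∃ i, i ≠ j ∧ b i ≠ 0 ∧ s.r i ≠ 0 ∧ (((d i).choose (p ^ m) : ℕ) : K) ≠ 0) →
      Nat.find hP ≤ m := fun hm => Nat.find_min' hP hm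
  set κ : ℕ := Nat.find hP with hκdef
  obtain ⟨d₀, hd₀, hd₀deg, i₀, hi₀, hbi₀, hri₀, hd₀i⟩ := hspec
  have hκmin : ∀ k, k < κ → ∀ d ∈ s.F.support, d.degree = o →
      ∀ i, i ≠ j → b i ≠ 0 → s.r i ≠ 0 → (((d i).choose (p ^ k) : ℕ) : K) = 0 := by
    intro k hk d hd hddeg i hij hbi hri
    by_contra hne
    exact hmin' hk ⟨d, hd, hddeg, i, hij, hbi, hri, hne⟩
  have hκe : κ < e := by
    obtain ⟨k, hk, hk0⟩ := exists_natCast_choose_prime_pow_ne_zero p K hd₁i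
    exact lt_of_le_of_lt (hle' ⟨d₁, hd₁, hd₁deg, i₁, hi₁, hbi₁, hri₁, hk0⟩) hk
  have hπq : p ^ κ ∣ q := pow_dvd_pow p hκe.le
  -- every exponent of every initial monomial of `F` is divisible by `π = p^κ`
  have hπ : ∀ d ∈ s.F.support, d.degree = o → ∀ t, p ^ κ ∣ d t := by
    intro d hd hddeg
    have hne : ∀ t, t ≠ j → p ^ κ ∣ d t := by
      intro t htj
      by_cases hbt : b t = 0
      · exact dvd_trans hπq (hfix t htj (Or.inl hbt) d hd hddeg)
      · by_cases hrt : s.r t = 0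
        · exact dvd_trans hπq (hfix t htj (Or.inr hrt) d hd hddeg)
        · exact pow_dvd_of_forall_natCast_choose_eq_zero p K
            (fun k hk => hκmin k hk d hd hddeg t htj hbt hrt)
    intro t
    by_cases htj : t = j
    · rw [htj]
      have hsum : p ^ κ ∣ ∑ i ∈ univ.erase j, d i :=
        Finset.dvd_sum fun i hi => hne i (Finset.ne_of_mem_erase hi)
      have htot : p ^ κ ∣ d.degree := by
        rw [hddeg]; exact dvd_trans hπq hqdvd
      rw [degree_eq_add_sum_erase j d] at htot
      exact (Nat.dvd_add_left hsum).mp htot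
    · exact hne t htj
  -- the Hasse probe at the minimising pair `(d₀, i₀)`: `E` in the lowest layer of `F′`
  obtain ⟨E, hE, -, hEj, hEdeg⟩ :=
    exists_support_step_of_choose_ne_zero' p j b hbj s ho hqo hr hi₀ hκe hd₀ hd₀deg hd₀i
  -- (1) `|E| ≤ θ + min(π, r_{i₀})`
  have hrmo : (s.r - Finsupp.single i₀ (p ^ κ)).degree + p ^ κ ≤ o := by
    have hle : (s.r - Finsupp.single i₀ (p ^ κ)) + Finsupp.single i₀ (p ^ κ) ≤ d₀ := by
      rw [Finsupp.le_def]
      intro i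
      rw [Finsupp.add_apply, Finsupp.tsub_apply, Finsupp.single_apply]
      by_cases hi : i₀ = i
      · subst hi
        rw [if_pos rfl]
        have ha : p ^ κ ≤ d₀ i₀ := by
          by_contra hlt
          exact hd₀i (by rw [Nat.choose_eq_zero_of_lt (not_le.mp hlt), Nat.cast_zero])
        have := Finsupp.le_def.mp (hr d₀ hd₀) i₀
        omega
      · rw [if_neg hi, add_zero, Nat.sub_zero]
        exact Finsupp.le_def.mp (hr d₀ hd₀) i
    have := degree_le_degree_of_le hle
    rw [map_add, Finsupp.degree_single, hd₀deg] at this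
    exact this
  have hb := hasseProbe_bound_le j b hbj s ho i₀ hrmo (q := q)
  have h1 : E.degree ≤ (newMult q j b s).degree + (o - s.r.degree) + min (p ^ κ) (s.r i₀) :=
    le_trans hEdeg hb
  -- (2) the first increase: `θ < o₁`
  have hthr : (newMult q j b s).degree + (o - s.r.degree) < o₁ := by
    have h := hinc
    unfold ShadeIncreases at h
    rw [shade_eq_of_ordZero_eq s ho, shade_eq_of_ordZero_eq (step q j b s) ho₁] at h
    have h' : o - s.r.degree < o₁ - (step q j b s).r.degree := by exact_mod_cast h
    change o - s.r.degree < o₁ - (newMult q j b s).degree at h'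
    omega
  -- (3) `E` is not initial (Case B), so `|E| > o₁`
  have hEo₁ : o₁ ≤ E.degree := hdeg₁ E hE
  have hEne : E.degree ≠ o₁ := by
    intro h
    have := hB E hE h
    omega
  -- (4) `π ∣ |E|`: `E` is a Taylor monomial of the chart image of an initial monomial of `F`
  have hπE : p ^ κ ∣ E.degree := by
    have hEG : coeff E (pointTransform q j b s) ≠ 0 := by
      have h := MvPolynomial.mem_support_iff.mp hE
      change coeff E (deletePthPowers q (pointTransform q j b s)) ≠ 0 at h
      rw [coeff_deletePthPowers] at h
      split_ifs at h with hP'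
      · exact (h rfl).elim
      · exact h
    rw [pointTransform_eq_sum, coeff_sum] at hEG
    obtain ⟨d, hd, hne⟩ := Finset.exists_ne_zero_of_sum_ne_zero hEG
    have hdo : d.degree = o := by
      have h1' : E j = chartExponent q j d j := apply_eq_of_coeff_translate_monomial_ne_zero b hbj hne
      rw [chartExponent_apply, if_pos rfl, hEj] at h1'
      have h2 := hdeg d hd
      omega
    have hce : ∀ t, p ^ κ ∣ chartExponent q j d t := by
      intro t
      rw [chartExponent_apply]
      by_cases htj : t = j
      · rw [if_pos htj, hdo]
        exact Nat.dvd_sub (dvd_trans hπq hqdvd) hπq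
      · rw [if_neg htj]
        exact hπ d hd hdo t
    have hEt : ∀ t, p ^ κ ∣ E t := fun t =>
      pow_dvd_apply_of_coeff_translate_monomial_ne_zero p b hce hne t
    rw [Finsupp.degree_eq_sum]
    exact Finset.dvd_sum fun t _ => hEt t
  -- (5) `π ∣ o₁`; hence `|E| ≥ o₁ + π > θ + min(π, r_{i₀}) ≥ |E|`
  have hπo₁ : p ^ κ ∣ o₁ := dvd_trans hπq hqdvd₁
  have hdiff : p ^ κ ∣ E.degree - o₁ := Nat.dvd_sub hπE hπo₁
  have hpos : 0 < E.degree - o₁ := by omega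
  have hle := Nat.le_of_dvd hpos hdiff
  have hmin : min (p ^ κ) (s.r i₀) ≤ p ^ κ := min_le_left _ _
  omega

/-- The same, with "the order is still `≥ q`" as `(q : ℕ∞) ≤ ord₀ F′` (the form of the `e = 1`
theorem `not_shadeIncreases_step_of_shadeIncreases`). [folklore] -/
theorem not_shadeIncreases_step_of_shadeIncreases_pow' {e : ℕ} (j : σ) (b : σ → K) (hbj : b j = 0)
    (s : State σ K) (hclean : deletePthPowers (p ^ e) s.F = s.F) {o : ℕ} (ho : ordZero s.F = o)
    (hqo : p ^ e ≤ o) (hr : ∀ d ∈ s.F.support, s.r ≤ d) (hinc : ShadeIncreases (p ^ e) j b s)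
    (j' : σ) (b' : σ → K) (hbj' : b' j' = 0)
    (hord : ((p ^ e : ℕ) : ℕ∞) ≤ ordZero (step (p ^ e) j b s).F) :
    ¬ ShadeIncreases (p ^ e) j' b' (step (p ^ e) j b s) := by
  have hne0 := step_F_ne_zero_pow p j b hbj s hclean ho hqo hr
  have hne : ordZero (step (p ^ e) j b s).F ≠ ⊤ := by
    unfold ordZero
    rw [Ne, MvPowerSeries.order_eq_top_iff, MvPolynomial.coe_eq_zero_iff]
    exact hne0
  obtain ⟨o₁, ho₁'⟩ := WithTop.ne_top_iff_exists.mp hne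
  have ho₁ : ordZero (step (p ^ e) j b s).F = o₁ := ho₁'.symm
  have hqo₁ : p ^ e ≤ o₁ := by
    rw [ho₁] at hord
    exact_mod_cast hord
  exact not_shadeIncreases_step_of_shadeIncreases_pow p j b hbj s hclean ho hqo hr hinc ho₁ hqo₁
    j' b' hbj'

/-- **A kangaroo point is never followed by a kangaroo point** (order `q = pᵉ`, every `e`, every
dimension): if `b` is a kangaroo point of the `y_j`-chart above the cleaned state `s` (order `≥ q`,
`yʳ ∣ F`) — equiconstant and shade-increasing, [Hauser2010] §G — then no point `b′` of any chart
above the new state is a kangaroo point. [folklore] -/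
theorem not_isKangarooPoint_step_of_isKangarooPoint {e : ℕ} (s : State σ K)
    (hclean : deletePthPowers (p ^ e) s.F = s.F) (hF : s.F ≠ 0)
    (hord : ((p ^ e : ℕ) : ℕ∞) ≤ ordZero s.F) (hr : ∀ d ∈ s.F.support, s.r ≤ d)
    {j : σ} {b : σ → K} (hK : IsKangarooPoint (p ^ e) j b s) (j' : σ) (b' : σ → K) :
    ¬ IsKangarooPoint (p ^ e) j' b' (step (p ^ e) j b s) := by
  rintro ⟨hbj', -, hinc'⟩
  obtain ⟨hbj, heq, hinc⟩ := hK
  have hne : ordZero s.F ≠ ⊤ := by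
    unfold ordZero
    rw [Ne, MvPowerSeries.order_eq_top_iff, MvPolynomial.coe_eq_zero_iff]
    exact hF
  obtain ⟨o, ho'⟩ := WithTop.ne_top_iff_exists.mp hne
  have ho : ordZero s.F = o := ho'.symm
  have hqo : p ^ e ≤ o := by
    rw [ho] at hord
    exact_mod_cast hord
  have hord₁ : ((p ^ e : ℕ) : ℕ∞) ≤ ordZero (step (p ^ e) j b s).F :=
    le_ordZero_step_of_isEquimultiplePoint (p ^ e) j b s heq
  exact not_shadeIncreases_step_of_shadeIncreases_pow' p j b hbj s hclean ho hqo hr hinc j' b' hbj'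
    hord₁ hinc'

/-- **Along a sequence of point blow-ups at order `pᵉ` (order `≥ q` throughout): increases are
isolated** — an increase at step `n` is followed by a non-increase at step `n + 1`; in particular
over any two consecutive steps the shade rises by at most `p^{e−1}`. Every dimension, every
`e ≥ 1`. (For `e ≥ 3` the shade may nevertheless diverge along suitable sequences,
`mohStabilityClaim_false`; nothing eventual is claimed here.) [folklore] -/
theorem shade_isolated_increases_along_pow {e : ℕ} (he : 1 ≤ e) (s : ℕ → State σ K) (j : ℕ → σ)
    (b : ℕ → σ → K) (hb : ∀ n, b n (j n) = 0)
    (hstep : ∀ n, s (n + 1) = step (p ^ e) (j n) (b n) (s n))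
    (hF0 : (s 0).F ≠ 0) (hclean : deletePthPowers (p ^ e) (s 0).F = (s 0).F)
    (hr : ∀ d ∈ (s 0).F.support, (s 0).r ≤ d)
    (hord : ∀ n, ((p ^ e : ℕ) : ℕ∞) ≤ ordZero (s n).F) (n : ℕ) :
    ((s n).shade < (s (n + 1)).shade → (s (n + 2)).shade ≤ (s (n + 1)).shade) ∧
    (s (n + 2)).shade ≤ (s n).shade + ((p ^ (e - 1) : ℕ) : ℕ∞) := by
  -- invariants along the sequence: non-zero, cleaned, divisible by the exceptional monomial
  have hinv : ∀ n, (s n).F ≠ 0 ∧ deletePthPowers (p ^ e) (s n).F = (s n).F ∧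
      ∀ d ∈ (s n).F.support, (s n).r ≤ d := by
    intro n
    induction n with
    | zero => exact ⟨hF0, hclean, hr⟩
    | succ n ih =>
      obtain ⟨ih0, ih1, ih2⟩ := ih
      have hne : ordZero (s n).F ≠ ⊤ := by
        unfold ordZero
        rw [Ne, MvPowerSeries.order_eq_top_iff, MvPolynomial.coe_eq_zero_iff]
        exact ih0
      obtain ⟨o, ho'⟩ := WithTop.ne_top_iff_exists.mp hne
      have ho : ordZero (s n).F = o := ho'.symm
      have hqo : p ^ e ≤ o := by
        have := hord n
        rw [ho] at this
        exact_mod_cast this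
      rw [hstep n]
      exact ⟨step_F_ne_zero_pow p (j n) (b n) (hb n) (s n) ih1 ho hqo ih2,
        deletePthPowers_step (p ^ e) (j n) (b n) (s n),
        newMult_le_of_mem_support_step (p ^ e) (j n) (b n) (hb n) (s n) ho ih2⟩
  obtain ⟨h0, h1, h2⟩ := hinv n
  have hne : ordZero (s n).F ≠ ⊤ := by
    unfold ordZero
    rw [Ne, MvPowerSeries.order_eq_top_iff, MvPolynomial.coe_eq_zero_iff]
    exact h0
  obtain ⟨o, ho'⟩ := WithTop.ne_top_iff_exists.mp hne
  have ho : ordZero (s n).F = o := ho'.symm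
  have hqo : p ^ e ≤ o := by
    have := hord n
    rw [ho] at this
    exact_mod_cast this
  have hfirst : (s n).shade < (s (n + 1)).shade → (s (n + 2)).shade ≤ (s (n + 1)).shade := by
    intro hlt
    have hinc : ShadeIncreases (p ^ e) (j n) (b n) (s n) := by
      unfold ShadeIncreases
      rw [← hstep n]
      exact hlt
    have hord1 : ((p ^ e : ℕ) : ℕ∞) ≤ ordZero (step (p ^ e) (j n) (b n) (s n)).F := by
      rw [← hstep n]; exact hord (n + 1)
    have := not_shadeIncreases_step_of_shadeIncreases_pow' p (j n) (b n) (hb n) (s n) h1 ho hqo h2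
      hinc (j (n + 1)) (b (n + 1)) (hb (n + 1)) hord1
    unfold ShadeIncreases at this
    rw [← hstep n, ← hstep (n + 1)] at this
    exact not_lt.mp this
  refine ⟨hfirst, ?_⟩
  have hM1 := shade_succ_le_along_pow p he s j b hb hstep hclean hr hord n
  have hM2 := shade_succ_le_along_pow p he s j b hb hstep hclean hr hord (n + 1)
  by_cases hlt : (s n).shade < (s (n + 1)).shade
  · exact le_trans (hfirst hlt) hM1
  · exact le_trans hM2 (add_le_add (not_lt.mp hlt) le_rfl)


/-! ### After a jump with `q ∣ ord₀ F′`: Moh's term `A` is initial, and his case (1) at every `e` -/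

/-- **Moh's term `A` at every `e`.** After an increase of the shade at the point `b` of the
`y_j`-chart (cleaned state, `yʳ ∣ F`, `ord₀ F = o ≥ q = pᵉ`), if the new order `o₁ = ord₀ F′` is
divisible by `q`, then there are a lost exceptional index `i₀` (`i₀ ≠ j`, `b_{i₀} ≠ 0`, `r_{i₀} ≠ 0`,
hence `r′_{i₀} = 0`) and an INITIAL monomial `y^E` of `F′` (`|E| = o₁`) in the lowest `y_j`-layer
(`E_j = o − q`) with `q ∤ E_{i₀}` and `shade′ ≤ shade + E_{i₀}`. (The Hasse probe monomial at the
least Hasse digit `κ`: its degree is `≡ o₁ (mod p^κ)` and `< o₁ + p^κ`.) Derived by the cell;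
[Moh1987] p. 972 has the term `A` after a maximal jump along a valuation. [folklore] -/
theorem exists_initial_lowestLayer_of_pow_dvd {e : ℕ} (j : σ) (b : σ → K) (hbj : b j = 0)
    (s : State σ K) (hclean : deletePthPowers (p ^ e) s.F = s.F) {o : ℕ} (ho : ordZero s.F = o)
    (hqo : p ^ e ≤ o) (hr : ∀ d ∈ s.F.support, s.r ≤ d) (hinc : ShadeIncreases (p ^ e) j b s)
    {o₁ : ℕ} (ho₁ : ordZero (step (p ^ e) j b s).F = o₁) (hdvd : p ^ e ∣ o₁) :
    ∃ i₀, i₀ ≠ j ∧ b i₀ ≠ 0 ∧ s.r i₀ ≠ 0 ∧ (step (p ^ e) j b s).r i₀ = 0 ∧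
      ∃ E ∈ (step (p ^ e) j b s).F.support, E.degree = o₁ ∧ E j = o - p ^ e ∧ ¬ p ^ e ∣ E i₀ ∧
        (step (p ^ e) j b s).shade ≤ s.shade + (E i₀ : ℕ∞) := by
  set q : ℕ := p ^ e with hqdef
  have hdeg := le_degree_of_ordZero_eq s ho
  have hdeg₁ := le_degree_of_ordZero_eq (step q j b s) ho₁
  obtain ⟨hqdvd, hfix, i₁, hi₁, hbi₁, hri₁, d₁, hd₁, hd₁deg, hd₁i⟩ :=
    necessary_of_shadeIncreases_pow p j b hbj s hclean ho hqo hr hinc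
  -- `κ`: the least Hasse digit at which a lost exceptional index sees an initial exponent
  have hP : ∃ k, ∃ d ∈ s.F.support, d.degree = o ∧ ∃ i, i ≠ j ∧ b i ≠ 0 ∧ s.r i ≠ 0 ∧
      (((d i).choose (p ^ k) : ℕ) : K) ≠ 0 := by
    obtain ⟨k, -, hk0⟩ := exists_natCast_choose_prime_pow_ne_zero p K hd₁i
    exact ⟨k, d₁, hd₁, hd₁deg, i₁, hi₁, hbi₁, hri₁, hk0⟩
  classical
  have hspec := Nat.find_spec hP
  have hmin' : ∀ {m : ℕ}, m < Nat.find hP → ¬ (∃ d ∈ s.F.support, d.degree = o ∧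
      ∃ i, i ≠ j ∧ b i ≠ 0 ∧ s.r i ≠ 0 ∧ (((d i).choose (p ^ m) : ℕ) : K) ≠ 0) :=
    fun hm => Nat.find_min hP hm
  have hle' : ∀ {m : ℕ}, (∃ d ∈ s.F.support, d.degree = o ∧
      ∃ i, i ≠ j ∧ b i ≠ 0 ∧ s.r i ≠ 0 ∧ (((d i).choose (p ^ m) : ℕ) : K) ≠ 0) →
      Nat.find hP ≤ m := fun hm => Nat.find_min' hP hm
  set κ : ℕ := Nat.find hP with hκdef
  obtain ⟨d₀, hd₀, hd₀deg, i₀, hi₀, hbi₀, hri₀, hd₀i⟩ := hspec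
  have hκmin : ∀ k, k < κ → ∀ d ∈ s.F.support, d.degree = o →
      ∀ i, i ≠ j → b i ≠ 0 → s.r i ≠ 0 → (((d i).choose (p ^ k) : ℕ) : K) = 0 := by
    intro k hk d hd hddeg i hij hbi hri
    by_contra hne
    exact hmin' hk ⟨d, hd, hddeg, i, hij, hbi, hri, hne⟩
  have hκe : κ < e := by
    obtain ⟨k, hk, hk0⟩ := exists_natCast_choose_prime_pow_ne_zero p K hd₁i
    exact lt_of_le_of_lt (hle' ⟨d₁, hd₁, hd₁deg, i₁, hi₁, hbi₁, hri₁, hk0⟩) hk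
  have hπq : p ^ κ ∣ q := pow_dvd_pow p hκe.le
  have hπ : ∀ d ∈ s.F.support, d.degree = o → ∀ t, p ^ κ ∣ d t := by
    intro d hd hddeg
    have hne : ∀ t, t ≠ j → p ^ κ ∣ d t := by
      intro t htj
      by_cases hbt : b t = 0
      · exact dvd_trans hπq (hfix t htj (Or.inl hbt) d hd hddeg)
      · by_cases hrt : s.r t = 0
        · exact dvd_trans hπq (hfix t htj (Or.inr hrt) d hd hddeg)
        · exact pow_dvd_of_forall_natCast_choose_eq_zero p K
            (fun k hk => hκmin k hk d hd hddeg t htj hbt hrt)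
    intro t
    by_cases htj : t = j
    · rw [htj]
      have hsum : p ^ κ ∣ ∑ i ∈ univ.erase j, d i :=
        Finset.dvd_sum fun i hi => hne i (Finset.ne_of_mem_erase hi)
      have htot : p ^ κ ∣ d.degree := by
        rw [hddeg]; exact dvd_trans hπq hqdvd
      rw [degree_eq_add_sum_erase j d] at htot
      exact (Nat.dvd_add_left hsum).mp htot
    · exact hne t htj
  -- the Hasse probe at `(d₀, i₀, κ)`
  obtain ⟨E, hE, hEi₀, hEj, hEdeg⟩ :=
    exists_support_step_of_choose_ne_zero' p j b hbj s ho hqo hr hi₀ hκe hd₀ hd₀deg hd₀i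
  have hrmo : (s.r - Finsupp.single i₀ (p ^ κ)).degree + p ^ κ ≤ o := by
    have hle : (s.r - Finsupp.single i₀ (p ^ κ)) + Finsupp.single i₀ (p ^ κ) ≤ d₀ := by
      rw [Finsupp.le_def]
      intro i
      rw [Finsupp.add_apply, Finsupp.tsub_apply, Finsupp.single_apply]
      by_cases hi : i₀ = i
      · subst hi
        rw [if_pos rfl]
        have ha : p ^ κ ≤ d₀ i₀ := by
          by_contra hlt
          exact hd₀i (by rw [Nat.choose_eq_zero_of_lt (not_le.mp hlt), Nat.cast_zero])
        have := Finsupp.le_def.mp (hr d₀ hd₀) i₀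
        omega
      · rw [if_neg hi, add_zero, Nat.sub_zero]
        exact Finsupp.le_def.mp (hr d₀ hd₀) i
    have := degree_le_degree_of_le hle
    rw [map_add, Finsupp.degree_single, hd₀deg] at this
    exact this
  have hb := hasseProbe_bound_le j b hbj s ho i₀ hrmo (q := q)
  have h1 : E.degree ≤ (newMult q j b s).degree + (o - s.r.degree) + min (p ^ κ) (s.r i₀) :=
    le_trans hEdeg hb
  have hthr : (newMult q j b s).degree + (o - s.r.degree) < o₁ := by
    have h := hinc
    unfold ShadeIncreases at h
    rw [shade_eq_of_ordZero_eq s ho, shade_eq_of_ordZero_eq (step q j b s) ho₁] at h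
    have h' : o - s.r.degree < o₁ - (step q j b s).r.degree := by exact_mod_cast h
    change o - s.r.degree < o₁ - (newMult q j b s).degree at h'
    omega
  have hEo₁ : o₁ ≤ E.degree := hdeg₁ E hE
  -- provenance of `E`: all its exponents are divisible by `π`
  have hEG : coeff E (pointTransform q j b s) ≠ 0 := by
    have h := MvPolynomial.mem_support_iff.mp hE
    change coeff E (deletePthPowers q (pointTransform q j b s)) ≠ 0 at h
    rw [coeff_deletePthPowers] at h
    split_ifs at h with hP'
    · exact (h rfl).elim
    · exact h
  rw [pointTransform_eq_sum, coeff_sum] at hEG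
  obtain ⟨d, hd, hne⟩ := Finset.exists_ne_zero_of_sum_ne_zero hEG
  have hdo : d.degree = o := by
    have h1' : E j = chartExponent q j d j := apply_eq_of_coeff_translate_monomial_ne_zero b hbj hne
    rw [chartExponent_apply, if_pos rfl, hEj] at h1'
    have h2 := hdeg d hd
    omega
  have hce : ∀ t, p ^ κ ∣ chartExponent q j d t := by
    intro t
    rw [chartExponent_apply]
    by_cases htj : t = j
    · rw [if_pos htj, hdo]
      exact Nat.dvd_sub (dvd_trans hπq hqdvd) hπq
    · rw [if_neg htj]
      exact hπ d hd hdo t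
  have hEt : ∀ t, p ^ κ ∣ E t := fun t =>
    pow_dvd_apply_of_coeff_translate_monomial_ne_zero p b hce hne t
  have hπE : p ^ κ ∣ E.degree := by
    rw [Finsupp.degree_eq_sum]
    exact Finset.dvd_sum fun t _ => hEt t
  have hπo₁ : p ^ κ ∣ o₁ := dvd_trans hπq hdvd
  -- `|E| = o₁`
  have hEdeg' : E.degree = o₁ := by
    by_contra hne'
    have hdiff : p ^ κ ∣ E.degree - o₁ := Nat.dvd_sub hπE hπo₁
    have hpos : 0 < E.degree - o₁ := by omega
    have hle := Nat.le_of_dvd hpos hdiff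
    have hmin : min (p ^ κ) (s.r i₀) ≤ p ^ κ := min_le_left _ _
    omega
  -- `π ≤ E_{i₀}` (digit `κ` of `E_{i₀}` is non-zero, the lower ones vanish)
  have hEi₀0 : E i₀ ≠ 0 := fun h0 => hEi₀ (by rw [h0]; exact dvd_zero _)
  have hπEi₀ : p ^ κ ≤ E i₀ := Nat.le_of_dvd (Nat.pos_of_ne_zero hEi₀0) (hEt i₀)
  have hr1i₀ : (step q j b s).r i₀ = 0 := by
    show newMult q j b s i₀ = 0
    rw [newMult_eq q j b hbj s ho, Finsupp.filter_apply, if_neg hbi₀]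
  refine ⟨i₀, hi₀, hbi₀, hri₀, hr1i₀, E, hE, hEdeg', hEj, hEi₀, ?_⟩
  rw [shade_eq_of_ordZero_eq s ho, shade_eq_of_ordZero_eq (step q j b s) ho₁]
  change ((o₁ - (newMult q j b s).degree : ℕ) : ℕ∞) ≤ ((o - s.r.degree : ℕ) : ℕ∞) + (E i₀ : ℕ∞)
  have hmin : min (p ^ κ) (s.r i₀) ≤ p ^ κ := min_le_left _ _
  have : o₁ - (newMult q j b s).degree ≤ (o - s.r.degree) + E i₀ := by omega
  exact_mod_cast this

/-- **Moh's case (1) at every `e`, valuation-free.** After an increase of the shade at `(j, b)` with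
`q ∣ ord₀ F′` (the only case in which a second increase is arithmetically possible, and excluded by
`not_shadeIncreases_step_of_shadeIncreases_pow`), there is a lost exceptional index `i₀` such that
the blow-up of the ORIGIN of the `y_{i₀}`-chart of the new state (no translation) brings the shade
back to AT MOST ITS VALUE BEFORE THE JUMP: `shade″ ≤ shade` — "In the first case, we have to factor
out `x_s` and do it without any translation. Due to the existence of the term `A`, the order of `F`
will drop at least by `c` which is `> pʳ`. Hence the order of `F` will drop to `d′ ≤ d`"
([Moh1987] p. 972, case (1)), here for every `e`, every dimension, every field of characteristic
`p`, at arbitrary (not valuation-prescribed) jump points. [cite: Moh1987, §1 (p. 972, case (1))] -/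
theorem exists_shade_step_origin_le_of_pow_dvd {e : ℕ} (j : σ) (b : σ → K) (hbj : b j = 0)
    (s : State σ K) (hclean : deletePthPowers (p ^ e) s.F = s.F) {o : ℕ} (ho : ordZero s.F = o)
    (hqo : p ^ e ≤ o) (hr : ∀ d ∈ s.F.support, s.r ≤ d) (hinc : ShadeIncreases (p ^ e) j b s)
    {o₁ : ℕ} (ho₁ : ordZero (step (p ^ e) j b s).F = o₁) (hqo₁ : p ^ e ≤ o₁)
    (hdvd : p ^ e ∣ o₁) :
    ∃ i₀, i₀ ≠ j ∧ b i₀ ≠ 0 ∧ s.r i₀ ≠ 0 ∧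
      (step (p ^ e) i₀ (fun _ => 0) (step (p ^ e) j b s)).shade ≤ s.shade := by
  obtain ⟨i₀, hi₀, hbi₀, hri₀, hr1i₀, E, hE, hEdeg, -, hEi₀, hshade⟩ :=
    exists_initial_lowestLayer_of_pow_dvd p j b hbj s hclean ho hqo hr hinc ho₁ hdvd
  have hr₁ := newMult_le_of_mem_support_step (p ^ e) j b hbj s ho hr
  have hdrop := shade_step_add_le_of_untranslated (p ^ e) i₀ (fun _ => (0 : K)) (fun _ => rfl)
    (step (p ^ e) j b s) ho₁ hqo₁ hr₁ hr1i₀ hE hEdeg hEi₀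
  refine ⟨i₀, hi₀, hbi₀, hri₀, ?_⟩
  have h := le_trans hdrop hshade
  exact (ENat.add_le_add_iff_right (ENat.coe_ne_top (E i₀))).mp h

end Main

end PointBlowup

end Literature.AlgebraicGeometry.Resolution

end
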